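import Literature.MathematicalPhysics.QuantumLattice.WilsonDiracAP
import Summits.QuantumFields.QCD.Theorems.QuarksAsStableActionCriticalLineDiamagnetismStubHadamardUpper
import Summits.QuantumFields.QCD.Theorems.QuarksAsStableActionCriticalLineDiamagnetismStubFreeDetFormula
import Summits.QuantumFields.QCD.Theorems.QuarksAsStableActionCriticalLineDiamagnetismStubFreeSymbolSum
import Summits.QuantumFields.QCD.Theorems.QuarksAsStableActionCriticalLineDiamagnetismStubCellIncidence
import Summits.QuantumFields.QCD.Theorems.QuarksAsStableActionCriticalLineDiamagnetismStubQuarkChessboardOfSchwarz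
import Summits.QuantumFields.QCD.Theorems.QuarksAsStableActionCriticalLineDiamagnetismStubCellGainOfGauged
import Summits.QuantumFields.QCD.Theorems.QuarksAsStableActionCriticalLineDiamagnetismStubBlochFactorisation
import Summits.QuantumFields.QCD.Theorems.QuarksAsStableActionCriticalLineDiamagnetismStubFreeBlochBlocks
import Summits.QuantumFields.QCD.Theorems.QuarksAsStableActionCriticalLineDiamagnetismStubCellDetFactorisation
import Summits.QuantumFields.QCD.Theorems.QuarksAsStableActionCriticalLineDiamagnetismStubDetPerturbIR
import Summits.QuantumFields.QCD.Theorems.QuarksAsStableActionCriticalLineDiamagnetismStubLogDetSecondOrder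
import Summits.QuantumFields.QCD.Theorems.QuarksAsStableActionCriticalLineDiamagnetismStubDeltaBounds
import Summits.QuantumFields.QCD.Theorems.QuarksAsStableActionCriticalLineDiamagnetismStubBlochLatticeSum
import Summits.QuantumFields.QCD.Theorems.QuarksAsStableActionCriticalLineDiamagnetismStubTilingCellData
import Summits.QuantumFields.QCD.Theorems.QuarksAsStableActionCriticalLineDiamagnetismStubCellGainTilingGlue
import Summits.QuantumFields.QCD.Theorems.QuarksAsStableActionCriticalLineDiamagnetismStubBlockEstimate
import Summits.QuantumFields.QCD.Theorems.QuarksAsStableActionCriticalLineDiamagnetismStubCellGainCore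
import Summits.QuantumFields.QCD.Theorems.QuarksAsStableActionCriticalLineDiamagnetismStubCellRegauge
import Summits.QuantumFields.QCD.Theorems.QuarksAsStableActionCriticalLineDiamagnetismStubBackgroundSchwarz
import Summits.QuantumFields.QCD.Theorems.QuarksAsStableActionCriticalLineDiamagnetismStubTadpole
import Summits.QuantumFields.QCD.Theorems.QuarksAsStableActionCriticalLineDiamagnetismStubUnitaryCellIneq
import Summits.QuantumFields.QCD.Theorems.QuarksAsStableActionCriticalLineDiamagnetismStubBilinearBounds
import Summits.QuantumFields.QCD.Theorems.QuarksAsStableActionCriticalLineDiamagnetismStubOneLoopMarginOfAux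
import Summits.QuantumFields.QCD.Theorems.QuarksAsStableActionCriticalLineDiamagnetismStubTilingCombinatorics
import Summits.QuantumFields.QCD.Theorems.QuarksAsStableActionCriticalLineDiamagnetismStubTwistCounting
import Summits.QuantumFields.QCD.Theorems.QuarksAsStableActionCriticalLineDiamagnetismStubMassLipschitz
import Summits.QuantumFields.QCD.Theorems.QuarksAsStableActionCriticalLineDiamagnetismStubWardKernel
import Summits.QuantumFields.QCD.Theorems.QuarksAsStableActionCriticalLineDiamagnetismStubBlockMargin3b
import Summits.QuantumFields.QCD.Theorems.QuarksAsStableActionCriticalLineDiamagnetismStubBlockMargin0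
import Summits.QuantumFields.QCD.Theorems.QuarksAsStableActionCriticalLineDiamagnetismStubBlockMargin1
import Summits.QuantumFields.QCD.Theorems.QuarksAsStableActionCriticalLineDiamagnetismStubBlockMargin2
import Summits.QuantumFields.QCD.Theorems.QuarksAsStableActionCriticalLineDiamagnetismStubBlockMargin3a
import Summits.QuantumFields.QCD.Theorems.QuarksAsStableActionCriticalLineDiamagnetismStubGaugeCoercive
import Summits.QuantumFields.QCD.Theorems.QuarksAsStableActionCriticalLineDiamagnetismHessianMarginOfStubsAux
import Summits.QuantumFields.QCD.Theorems.QuarksAsStableActionCriticalLineDiamagnetismStubCornerCounting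
import Summits.QuantumFields.QCD.Theorems.QuarksAsStableActionCriticalLineDiamagnetismHessianMarginOfStubsAux2
import Summits.QuantumFields.QCD.Theorems.QuarksAsStableActionCriticalLineDiamagnetismStubHessianMargin

/-!
# Stub P6 — `stub_oneLoopMargin`: the one-loop cell margin (crux stmt-QuantumFields-9734, line `Sketch`, lead c3)

What. The registered stub `stub_oneLoopMargin` of the skeleton (`Lines/Sketch.lean`): the quadratic lower bound
`cq·defect − Cq·(mass and boundary terms) ≤ (one-loop cell functional)` for all cells of the `(2M)⁴` torus at `|m| ≤ ε`,
uniformly in `M ≥ M₀` (exact statement = the registered signature).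

How. The skeleton's ASSEMBLY (`stub_oneLoopMargin_of`, formerly proved in-skeleton and attached as evidence), now a tree theorem:
tiling combinatorics `stub_tilingCombinatorics` (p129950), unitary cell inequality `stub_unitaryCellIneq` (p128572), bilinear
bounds `stub_bilinearBounds` (p128342), the tadpole `stub_tadpole` (p126868), the bookkeeping `…StubOneLoopMarginOfAux`
(p128862), and the Hessian margin `stub_hessianMargin` (`…StubHessianMargin.lean`). Computational (inherits the
`native_decide` certificates through `stub_hessianMargin`).
-/

noncomputable section

open scoped BigOperators Classical Matrix ComplexConjugate
open Finset
open Literature.MathematicalPhysics.QuantumLattice Literature.MathematicalPhysics.QuantumFieldTheory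
  Literature.Probability.LatticeModels

namespace Summit.QuantumFields.QCD.Cruxes.CriticalLineDiamagnetism.ChessboardCellGain

open CellGainCore OneLoopMarginOf in
/-- **Stub Asm — `oneLoopMargin_of` (assembly: T → C → U → Bd → Mg → P6) — PROVED in-skeleton (lead c3 wave 1 worker; file `work/stubs/StubOneLoopMarginOf.lean`, rc 0, attached as evidence; its hypothesis form exceeds the 4000-char registration limit, so it lands last as the registered `stub_oneLoopMargin` once Mg lands; aux lemmas LANDED p128862 `…StubOneLoopMarginOfAux.lean`).**  Given `M ≥ M₀`, `|m| ≤ ε := min ε_Mg ε_Σ ½`,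
`V, c, ω, ζ`, `η ≤ η₀ := 1` and η-close cell links: (0) `B_k − B⁰_k = Δ_k(E)`, `E = W_c − 1`
(`StubDeltaBounds.wilsonDirac_dir_sub_apply` + `ρ(uX) − ρ(u) = u(X−1)`, `ρ(uX)⁻¹ − ρ(u)⁻¹ = (u(X−1))ᴴ`), so
`Re tr R_k = ℓ_k(E)`, `Re tr R_k² = 𝔅_k(E,E)`; (1) `Im S_μ(E) = 0` and `Re S_μ(E) = −D_μ := −Σ_x d(W_c(x,μ))` by C(i)
(`tr W⁻¹ = conj tr W`), hence by T `Σ_k ℓ_k(E) = −Σ_μ T_μ D_μ`; (2) `E = Y + H`, Bd + U: `|𝔅_k(E,E) − 𝔅_k(Y,Y)| ≤ 128√η D / c₀(k)`,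
`D_μ = ½(‖Y‖²_μ + ‖H‖²_μ)`, `‖H‖² ≤ ηD`, `|T_μ| ≤ (80/√3) Σ_k c₀(k)^{-1/2}`; (3) so
`𝓠 ≤ −𝓗_M(Y) + √η D (64 Σ_k c₀(k)⁻¹ + 24 Σ_k c₀(k)^{-1/2})` (`η ≤ √η ≤ 1`); (4) Mg: `𝓗_M(Y) ≥ c′M⁴𝒦(Y)` (Y anti-Hermitian,
tiling-odd by C(i)); (5) U + C(ii): `4S = Σ_p d_p(W_c) ≤ 𝒦(Y) + 288ηD`; (6) lattice sums: `c₀(k) = min_s h_k(s) > 0`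
(`stub_freeBlochBlocks`, `CellGainCore.symbol_pos`), `c₀⁻¹, c₀^{-1/2} ≤ 1 + c₀^{-3/2} ≤ 1 + Σ_s h^{-3/2}`, `stub_blochLatticeSum`;
`D ≤ 2F`, max deficit of `W_c ≤ η` (`stub_tilingCellData`). Result: `cq = 4c′`, `Kq = 0`, `Cq = 2(288c′ + 64(16+C_Σ) + 24(16+C_Σ))`.
[difficulty: M — bookkeeping; pattern: `stub_cellGainCore`] -/
theorem stub_oneLoopMargin_of : (∀ (m : ℝ) (θ : Fin 4 → ℝ) (u : Fin 4 → Matrix.unitaryGroup (Fin 3) ℂ), (∀ μ, ((u μ : Matrix.unitaryGroup (Fin 3) ℂ) : Matrix (Fin 3) (Fin 3) ℂ) = Complex.exp (↑(θ μ) * Complex.I) • (1 : Matrix (Fin 3) (Fin 3) ℂ)) → let B0 : Matrix (TorusSite 4 2 × Fin 3 × Fin 4) (TorusSite 4 2 × Fin 3 × Fin 4) ℂ := wilsonDirac (unitaryFundamentalRep (Fin 3) ℂ) (fun e : Edge 4 2 => u e.2) m 1; let Dl : (Edge 4 2 → Matrix (Fin 3) (Fin 3) ℂ) → Matrix (TorusSite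 4 2 × Fin 3 × Fin 4) (TorusSite 4 2 × Fin 3 × Fin 4) ℂ := fun E => Matrix.of fun p q => -(1 / 2 : ℂ) * ∑ μ : Fin 4, ((if q.1 = Site.shift p.1 μ then ((1 : Matrix (Fin 4) (Fin 4) ℂ) - euclideanGamma μ) p.2.2 q.2.2 * (((u μ : Matrix.unitaryGroup (Fin 3) ℂ) : Matrix (Fin 3) (Fin 3) ℂ) * E (p.1, μ)) p.2.1 q.2.1 else 0) + (if p.1 = Site.shift q.1 μ then ((1 : Matrix (Fin 4) (Fin 4) ℂ) + euclideanGamma μ) p.2.2 q.2.2 * (((u μ : Matrix.unitaryGroup (Fin 3) ℂ) : Matrix (Fin 3) (Fin 3) ℂ) * E (q.1, μ))ᴴ p.2.1 q.2.1 else 0)); let ell : (Edge 4 2 → Matrix (Fin 3) (Fin 3) ℂ) → ℝ := fun E => (B0⁻¹ * Dl E).trace.re; let tst : Fin 4 → (Edge 4 2 → Matrix (Fin 3) (Fin 3) ℂ) := fun μ e => if e = ((0 : TorusSite 4 2), μ) then (1 / 3 : ℂ) • (1 : Matrix (Fin 3) (Fin 3) ℂ) else 0; ∀ E : Edge 4 2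 → Matrix (Fin 3) (Fin 3) ℂ, (∀ μ : Fin 4, (∑ x : TorusSite 4 2, (E (x, μ)).trace).im = 0) → ell E = ∑ μ : Fin 4, ell (tst μ) * (∑ x : TorusSite 4 2, (E (x, μ)).trace).re) → (∀ (M : ℕ) [NeZero M] (V : GaugeConfig 4 (2 * M) (Matrix.unitaryGroup (Fin 3) ℂ)) (c : Site 4 (2 * M)), let tile : Site 4 (2 * M) → GaugeConfig 4 (2 * M) (Matrix.unitaryGroup (Fin 3) ℂ) → GaugeConfig 4 (2 * M) (Matrix.unitaryGroup (Fin 3) ℂ) := fun c V e => if (e.1 e.2 - c e.2).val % 2 = 0 then V (fun ν => c ν + (((e.1 ν - c ν).val % 2 : ℕ) : ZMod (2 * M)), e.2) else (V (fun ν => c ν + (((Site.shift e.1 e.2 ν - c ν).val % 2 : ℕ) : ZMod (2 * M)), e.2))⁻¹; let Wc : GaugeConfig 4 2 (Matrix.unitaryGroup (Fin 3) ℂ) := fun e => tile c V (fun ν => c ν + (((e.1 ν).val : ℕ) : ZMod (2 * M)), e.2); (∀ (x : TorusSite 4 2) (μ : Fin 4), Wc (Site.shift x μ, μ) = (Wc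 (x, μ))⁻¹) ∧ ∑ p : Plaquette 4 2, (3 - (unitaryFundamentalRep (Fin 3) ℂ (plaquetteHolonomy Wc p.1 p.2.1.1 p.2.1.2)).trace.re) = 4 * ∑ p ∈ univ.filter (fun p : Plaquette 4 (2 * M) => p.1 p.2.1.1 = c p.2.1.1 ∧ p.1 p.2.1.2 = c p.2.1.2 ∧ ∀ ν, ν ≠ p.2.1.1 → ν ≠ p.2.1.2 → (p.1 ν = c ν ∨ p.1 ν = c ν + 1)), (3 - (unitaryFundamentalRep (Fin 3) ℂ (plaquetteHolonomy V p.1 p.2.1.1 p.2.1.2)).trace.re)) → (∀ (X : GaugeConfig 4 2 (Matrix.unitaryGroup (Fin 3) ℂ)) (η : ℝ), (∀ e : Edge 4 2, (3 - ((X e : Matrix.unitaryGroup (Fin 3) ℂ) : Matrix (Fin 3) (Fin 3) ℂ).trace.re) ≤ η) → let E : Edge 4 2 → Matrix (Fin 3) (Fin 3) ℂ := fun e => ((X e : Matrix.unitaryGroup (Fin 3) ℂ) : Matrix (Fin 3) (Fin 3) ℂ) - 1; let Y : Edge 4 2 → Matrix (Fin 3) (Fin 3) ℂ := fun e => (1 /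 2 : ℂ) • (E e - (E e)ᴴ); (∀ e : Edge 4 2, ∑ a, ∑ b, ‖E e a b‖ ^ 2 = 2 * (3 - ((X e : Matrix.unitaryGroup (Fin 3) ℂ) : Matrix (Fin 3) (Fin 3) ℂ).trace.re)) ∧ (∀ e : Edge 4 2, ∑ a, ∑ b, ‖E e a b‖ ^ 2 = (∑ a, ∑ b, ‖Y e a b‖ ^ 2) + ∑ a, ∑ b, ‖(E e - Y e) a b‖ ^ 2) ∧ (∀ e : Edge 4 2, ∑ a, ∑ b, ‖(E e - Y e) a b‖ ^ 2 ≤ η * (3 - ((X e : Matrix.unitaryGroup (Fin 3) ℂ) : Matrix (Fin 3) (Fin 3) ℂ).trace.re)) ∧ ∑ p : Plaquette 4 2, (3 - (unitaryFundamentalRep (Fin 3) ℂ (plaquetteHolonomy X p.1 p.2.1.1 p.2.1.2)).trace.re) ≤ (∑ p : Plaquette 4 2, ∑ a, ∑ b, ‖(Y (p.1, p.2.1.1) + Y (Site.shift p.1 p.2.1.1, p.2.1.2) - Y (Site.shift p.1 p.2.1.2, p.2.1.1) - Y (p.1, p.2.1.2)) a b‖ ^ 2) + 288 * η * ∑ e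 : Edge 4 2, (3 - ((X e : Matrix.unitaryGroup (Fin 3) ℂ) : Matrix (Fin 3) (Fin 3) ℂ).trace.re)) → (∀ (m : ℝ) (u : Fin 4 → Matrix.unitaryGroup (Fin 3) ℂ) (c₀ : ℝ), 0 < c₀ → let B0 : Matrix (TorusSite 4 2 × Fin 3 × Fin 4) (TorusSite 4 2 × Fin 3 × Fin 4) ℂ := wilsonDirac (unitaryFundamentalRep (Fin 3) ℂ) (fun e : Edge 4 2 => u e.2) m 1; let Dl : (Edge 4 2 → Matrix (Fin 3) (Fin 3) ℂ) → Matrix (TorusSite 4 2 × Fin 3 × Fin 4) (TorusSite 4 2 × Fin 3 × Fin 4) ℂ := fun E => Matrix.of fun p q => -(1 / 2 : ℂ) * ∑ μ : Fin 4, ((if q.1 = Site.shift p.1 μ then ((1 : Matrix (Fin 4) (Fin 4) ℂ) - euclideanGamma μ) p.2.2 q.2.2 * (((u μ : Matrix.unitaryGroup (Fin 3) ℂ) : Matrix (Fin 3) (Fin 3) ℂ) * E (p.1, μ)) p.2.1 q.2.1 else 0) + (if p.1 = Site.shift q.1 μ then ((1 : Matrix (Fin 4) (Fin 4) ℂ)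 + euclideanGamma μ) p.2.2 q.2.2 * (((u μ : Matrix.unitaryGroup (Fin 3) ℂ) : Matrix (Fin 3) (Fin 3) ℂ) * E (q.1, μ))ᴴ p.2.1 q.2.1 else 0)); let ell : (Edge 4 2 → Matrix (Fin 3) (Fin 3) ℂ) → ℝ := fun E => (B0⁻¹ * Dl E).trace.re; let bf : (Edge 4 2 → Matrix (Fin 3) (Fin 3) ℂ) → (Edge 4 2 → Matrix (Fin 3) (Fin 3) ℂ) → ℝ := fun E₁ E₂ => (B0⁻¹ * Dl E₁ * (B0⁻¹ * Dl E₂)).trace.re; (∀ v : TorusSite 4 2 × Fin 3 × Fin 4 → ℂ, c₀ * ∑ i, ‖v i‖ ^ 2 ≤ ∑ i, ‖(B0.mulVec v) i‖ ^ 2) → (∀ E₁ E₂ : Edge 4 2 → Matrix (Fin 3) (Fin 3) ℂ, Dl (E₁ + E₂) = Dl E₁ + Dl E₂) ∧ (∀ (r : ℝ) (E : Edge 4 2 → Matrix (Fin 3) (Fin 3) ℂ), Dl (r • E) = (r : ℂ) • Dl E) ∧ (∀ E₁ E₂ : Edge 4 2 → Matrix (Fin 3) (Fin 3) ℂ, |bf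 E₁ E₂| ≤ 32 / c₀ * Real.sqrt (∑ e, ∑ a, ∑ b, ‖E₁ e a b‖ ^ 2) * Real.sqrt (∑ e, ∑ a, ∑ b, ‖E₂ e a b‖ ^ 2)) ∧ (∀ E : Edge 4 2 → Matrix (Fin 3) (Fin 3) ℂ, |ell E| ≤ 80 / Real.sqrt c₀ * Real.sqrt (∑ e, ∑ a, ∑ b, ‖E e a b‖ ^ 2))) → (∃ c' ε : ℝ, 0 < c' ∧ 0 < ε ∧ ∃ M₀ : ℕ, ∀ (M : ℕ) [NeZero M], M₀ ≤ M → ∀ (m : ℝ), |m| ≤ ε → ∀ (ω : Matrix.unitaryGroup (Fin 3) ℂ) (ζ : (Fin 4 → Fin M) → Fin 4 → Matrix.unitaryGroup (Fin 3) ℂ), ((ω : Matrix.unitaryGroup (Fin 3) ℂ) : Matrix (Fin 3) (Fin 3) ℂ) = Complex.exp (↑(Real.pi / (2 * M : ℕ)) * Complex.I) • (1 : Matrix (Fin 3) (Fin 3) ℂ) → (∀ k μ, ((ζ k μ : Matrix.unitaryGroup (Fin 3) ℂ) : Matrix (Fin 3) (Fin 3) ℂ) = Complex.exp (Real.pi *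 Complex.I * ((k μ : ℕ) : ℂ) / (M : ℂ)) • (1 : Matrix (Fin 3) (Fin 3) ℂ)) → let B0 : (Fin 4 → Fin M) → Matrix (TorusSite 4 2 × Fin 3 × Fin 4) (TorusSite 4 2 × Fin 3 × Fin 4) ℂ := fun k => wilsonDirac (unitaryFundamentalRep (Fin 3) ℂ) (fun e : Edge 4 2 => ζ k e.2 * ω) m 1; let Dl : (Fin 4 → Fin M) → (Edge 4 2 → Matrix (Fin 3) (Fin 3) ℂ) → Matrix (TorusSite 4 2 × Fin 3 × Fin 4) (TorusSite 4 2 × Fin 3 × Fin 4) ℂ := fun k E => Matrix.of fun p q => -(1 / 2 : ℂ) * ∑ μ : Fin 4, ((if q.1 = Site.shift p.1 μ then ((1 : Matrix (Fin 4) (Fin 4) ℂ) - euclideanGamma μ) p.2.2 q.2.2 * (((ζ k μ * ω : Matrix.unitaryGroup (Fin 3) ℂ) : Matrix (Fin 3) (Fin 3) ℂ) * E (p.1, μ)) p.2.1 q.2.1 else 0) + (if p.1 = Site.shift q.1 μ then ((1 : Matrix (Fin 4) (Fin 4) ℂ) + euclideanGamma μ) p.2.2 q.2.2 * (((ζ k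 μ * ω : Matrix.unitaryGroup (Fin 3) ℂ) : Matrix (Fin 3) (Fin 3) ℂ) * E (q.1, μ))ᴴ p.2.1 q.2.1 else 0)); let ell : (Fin 4 → Fin M) → (Edge 4 2 → Matrix (Fin 3) (Fin 3) ℂ) → ℝ := fun k E => ((B0 k)⁻¹ * Dl k E).trace.re; let bf : (Fin 4 → Fin M) → (Edge 4 2 → Matrix (Fin 3) (Fin 3) ℂ) → (Edge 4 2 → Matrix (Fin 3) (Fin 3) ℂ) → ℝ := fun k E₁ E₂ => ((B0 k)⁻¹ * Dl k E₁ * ((B0 k)⁻¹ * Dl k E₂)).trace.re; let tst : Fin 4 → (Edge 4 2 → Matrix (Fin 3) (Fin 3) ℂ) := fun μ e => if e = ((0 : TorusSite 4 2), μ) then (1 / 3 : ℂ) • (1 : Matrix (Fin 3) (Fin 3) ℂ) else 0; let T : Fin 4 → ℝ := fun μ => ∑ k : Fin 4 → Fin M, ell k (tst μ); ∀ Y : Edge 4 2 → Matrix (Fin 3) (Fin 3) ℂ, (∀ e, (Y e)ᴴ = -Y e) → (∀ (x : TorusSite 4 2) (μ : Fin 4), Y (Site.shift x μ, μ) = -Y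 (x, μ)) → c' * (M : ℝ) ^ 4 * (∑ p : Plaquette 4 2, ∑ a, ∑ b, ‖(Y (p.1, p.2.1.1) + Y (Site.shift p.1 p.2.1.1, p.2.1.2) - Y (Site.shift p.1 p.2.1.2, p.2.1.1) - Y (p.1, p.2.1.2)) a b‖ ^ 2) ≤ (∑ k : Fin 4 → Fin M, bf k Y Y) / 2 + (∑ μ : Fin 4, T μ * ∑ x : TorusSite 4 2, ∑ a, ∑ b, ‖Y (x, μ) a b‖ ^ 2) / 2) → (∃ cq Cq Kq ε η₀ : ℝ, 0 < cq ∧ 0 < ε ∧ 0 < η₀ ∧ ∃ M₀ : ℕ, ∀ (M : ℕ) [NeZero M], M₀ ≤ M → ∀ (m : ℝ), |m| ≤ ε → ∀ (V : GaugeConfig 4 (2 * M) (Matrix.unitaryGroup (Fin 3) ℂ)) (c : Site 4 (2 * M)) (ω : Matrix.unitaryGroup (Fin 3) ℂ) (ζ : (Fin 4 → Fin M) → Fin 4 → Matrix.unitaryGroup (Fin 3) ℂ), ((ω : Matrix.unitaryGroup (Fin 3) ℂ) : Matrix (Fin 3) (Fin 3) ℂ) = Complex.exp (↑(Real.pi /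 (2 * M : ℕ)) * Complex.I) • (1 : Matrix (Fin 3) (Fin 3) ℂ) → (∀ k μ, ((ζ k μ : Matrix.unitaryGroup (Fin 3) ℂ) : Matrix (Fin 3) (Fin 3) ℂ) = Complex.exp (Real.pi * Complex.I * ((k μ : ℕ) : ℂ) / (M : ℂ)) • (1 : Matrix (Fin 3) (Fin 3) ℂ)) → ∀ η : ℝ, η ≤ η₀ → (∀ e : Edge 4 (2 * M), ((∀ ν, (e.1 ν - c ν).val ≤ 1) ∧ (e.1 e.2 - c e.2).val = 0) → 3 - ((V e : Matrix.unitaryGroup (Fin 3) ℂ) : Matrix (Fin 3) (Fin 3) ℂ).trace.re ≤ η) → let tile : Site 4 (2 * M) → GaugeConfig 4 (2 * M) (Matrix.unitaryGroup (Fin 3) ℂ) → GaugeConfig 4 (2 * M) (Matrix.unitaryGroup (Fin 3) ℂ) := fun c V e => if (e.1 e.2 - c e.2).val % 2 = 0 then V (fun ν => c ν + (((e.1 ν - c ν).val % 2 : ℕ) : ZMod (2 * M)), e.2) else (V (fun ν => c ν + (((Site.shift e.1 e.2 ν - c ν).val % 2 : ℕ) : ZMod (2 * M)), e.2))⁻¹;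 let Wc : GaugeConfig 4 2 (Matrix.unitaryGroup (Fin 3) ℂ) := fun e => tile c V (fun ν => c ν + (((e.1 ν).val : ℕ) : ZMod (2 * M)), e.2); let R : (Fin 4 → Fin M) → Matrix (TorusSite 4 2 × Fin 3 × Fin 4) (TorusSite 4 2 × Fin 3 × Fin 4) ℂ := fun k => (wilsonDirac (unitaryFundamentalRep (Fin 3) ℂ) (fun e : Edge 4 2 => ζ k e.2 * ω) m 1)⁻¹ * (wilsonDirac (unitaryFundamentalRep (Fin 3) ℂ) (fun e : Edge 4 2 => ζ k e.2 * ω * Wc e) m 1 - wilsonDirac (unitaryFundamentalRep (Fin 3) ℂ) (fun e : Edge 4 2 => ζ k e.2 * ω) m 1); ∑ k : Fin 4 → Fin M, ((R k).trace.re - ((R k) * (R k)).trace.re / 2) ≤ Kq - cq * (M : ℝ) ^ 4 * ∑ p ∈ univ.filter (fun p : Plaquette 4 (2 * M) => p.1 p.2.1.1 = c p.2.1.1 ∧ p.1 p.2.1.2 = c p.2.1.2 ∧ ∀ ν, ν ≠ p.2.1.1 → ν ≠ p.2.1.2 → (p.1 ν = c ν ∨ p.1 ν = c ν + 1)), (3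 - (unitaryFundamentalRep (Fin 3) ℂ (plaquetteHolonomy V p.1 p.2.1.1 p.2.1.2)).trace.re) + Cq * Real.sqrt η * (M : ℝ) ^ 4 * ∑ e ∈ univ.filter (fun e : Edge 4 (2 * M) => (∀ ν, (e.1 ν - c ν).val ≤ 1) ∧ (e.1 e.2 - c e.2).val = 0), (3 - ((V e : Matrix.unitaryGroup (Fin 3) ℂ) : Matrix (Fin 3) (Fin 3) ℂ).trace.re)) := by
  intro hT hC hU hBd hMg
  obtain ⟨c', εH, hc', hεH, M₀, hMg⟩ := hMg
  obtain ⟨CS, εS, hεS, hLS⟩ := stub_blochLatticeSum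
  refine ⟨4 * c', 2 * (288 * c' + 104 * (max CS 0 + 1)), 0, min εH εS, 1, by positivity,
    lt_min hεH hεS, one_pos, M₀, ?_⟩
  intro M _ hM m hm V c ω ζ hω hζ η hη1 hlinks tile Wc R
  have hmH : |m| ≤ εH := hm.trans (min_le_left _ _)
  have hmS : |m| ≤ εS := hm.trans (min_le_right _ _)
  -- the two cell sums
  set S : ℝ := ∑ p ∈ univ.filter (fun p : Plaquette 4 (2 * M) => p.1 p.2.1.1 = c p.2.1.1 ∧
      p.1 p.2.1.2 = c p.2.1.2 ∧ ∀ ν, ν ≠ p.2.1.1 → ν ≠ p.2.1.2 → (p.1 ν = c ν ∨ p.1 ν = c ν + 1)),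
    (3 - (unitaryFundamentalRep (Fin 3) ℂ (plaquetteHolonomy V p.1 p.2.1.1 p.2.1.2)).trace.re)
  set F : ℝ := ∑ e ∈ univ.filter (fun e : Edge 4 (2 * M) => (∀ ν, (e.1 ν - c ν).val ≤ 1) ∧
      (e.1 e.2 - c e.2).val = 0),
    (3 - ((V e : Matrix.unitaryGroup (Fin 3) ℂ) : Matrix (Fin 3) (Fin 3) ℂ).trace.re)
  -- (C) the tiling combinatorics
  obtain ⟨hWinv, hWS⟩ : (∀ (x : TorusSite 4 2) (μ : Fin 4), Wc (Site.shift x μ, μ) = (Wc (x, μ))⁻¹) ∧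
      ∑ p : Plaquette 4 2, (3 - (unitaryFundamentalRep (Fin 3) ℂ
        (plaquetteHolonomy Wc p.1 p.2.1.1 p.2.1.2)).trace.re) = 4 * S := hC M V c
  -- the tiling cell data: cell links and `D ≤ 2F`
  set D : ℝ := ∑ e : Edge 4 2,
    (3 - ((Wc e : Matrix.unitaryGroup (Fin 3) ℂ) : Matrix (Fin 3) (Fin 3) ℂ).trace.re) with hD_def
  obtain ⟨hWlink, hDF⟩ : (∀ e : Edge 4 2, ∃ e' : Edge 4 (2 * M),
      ((∀ ν, (e'.1 ν - c ν).val ≤ 1) ∧ (e'.1 e'.2 - c e'.2).val = 0) ∧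
        ((Wc e : Matrix.unitaryGroup (Fin 3) ℂ) : Matrix (Fin 3) (Fin 3) ℂ).trace.re =
          ((V e' : Matrix.unitaryGroup (Fin 3) ℂ) : Matrix (Fin 3) (Fin 3) ℂ).trace.re) ∧
      D ≤ 2 * F :=
    stub_tilingCellData M V c
  have hWη : ∀ e : Edge 4 2,
      3 - ((Wc e : Matrix.unitaryGroup (Fin 3) ℂ) : Matrix (Fin 3) (Fin 3) ℂ).trace.re ≤ η := by
    intro e
    obtain ⟨e', he', htr⟩ := hWlink e
    rw [htr]
    exact hlinks e' he'
  have hη0 : 0 ≤ η := (CellGainOfGauged.deficit_nonneg _).trans (hWη ((0 : TorusSite 4 2), 0))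
  have hD0 : 0 ≤ D := Finset.sum_nonneg fun e _ => CellGainOfGauged.deficit_nonneg _
  -- `E = W_c − 1 = Y + H`
  set E : Edge 4 2 → Matrix (Fin 3) (Fin 3) ℂ := fun e =>
    ((Wc e : Matrix.unitaryGroup (Fin 3) ℂ) : Matrix (Fin 3) (Fin 3) ℂ) - 1 with hE_def
  set Y : Edge 4 2 → Matrix (Fin 3) (Fin 3) ℂ := fun e => (1 / 2 : ℂ) • (E e - (E e)ᴴ) with hY_def
  set H : Edge 4 2 → Matrix (Fin 3) (Fin 3) ℂ := E - Y with hH_def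
  -- (U) the unitary cell inequalities
  set K : ℝ := ∑ p : Plaquette 4 2, ∑ a, ∑ b, ‖(Y (p.1, p.2.1.1) + Y (Site.shift p.1 p.2.1.1, p.2.1.2) -
    Y (Site.shift p.1 p.2.1.2, p.2.1.1) - Y (p.1, p.2.1.2)) a b‖ ^ 2
  obtain ⟨hE2, hPyth, hHle, hplaq⟩ :
      (∀ e : Edge 4 2, ∑ a, ∑ b, ‖E e a b‖ ^ 2 =
        2 * (3 - ((Wc e : Matrix.unitaryGroup (Fin 3) ℂ) : Matrix (Fin 3) (Fin 3) ℂ).trace.re)) ∧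
      (∀ e : Edge 4 2, ∑ a, ∑ b, ‖E e a b‖ ^ 2 = (∑ a, ∑ b, ‖Y e a b‖ ^ 2) + ∑ a, ∑ b, ‖H e a b‖ ^ 2) ∧
      (∀ e : Edge 4 2, ∑ a, ∑ b, ‖H e a b‖ ^ 2 ≤
        η * (3 - ((Wc e : Matrix.unitaryGroup (Fin 3) ℂ) : Matrix (Fin 3) (Fin 3) ℂ).trace.re)) ∧
      ∑ p : Plaquette 4 2, (3 - (unitaryFundamentalRep (Fin 3) ℂ
        (plaquetteHolonomy Wc p.1 p.2.1.1 p.2.1.2)).trace.re) ≤ K + 288 * η * D :=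
    hU Wc η hWη
  have hK : 4 * S ≤ K + 288 * η * D := hWS.symm.le.trans hplaq
  -- `Y` is anti-Hermitian and tiling-odd (C(i))
  have hYanti : ∀ e, (Y e)ᴴ = -Y e := fun e => conjTranspose_half_sub (E e)
  have hEsh : ∀ (x : TorusSite 4 2) (μ : Fin 4), E (Site.shift x μ, μ) = (E (x, μ))ᴴ := by
    intro x μ
    show ((Wc (Site.shift x μ, μ) : Matrix.unitaryGroup (Fin 3) ℂ) : Matrix (Fin 3) (Fin 3) ℂ) - 1 =
      ((((Wc (x, μ) : Matrix.unitaryGroup (Fin 3) ℂ)) : Matrix (Fin 3) (Fin 3) ℂ) - 1)ᴴ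
    rw [hWinv x μ, coe_inv_sub_one]
  have hYodd : ∀ (x : TorusSite 4 2) (μ : Fin 4), Y (Site.shift x μ, μ) = -Y (x, μ) := by
    intro x μ
    show (1 / 2 : ℂ) • (E (Site.shift x μ, μ) - (E (Site.shift x μ, μ))ᴴ) =
      -((1 / 2 : ℂ) • (E (x, μ) - (E (x, μ))ᴴ))
    rw [hEsh, half_sub_conjTranspose_of]
  -- the colour traces of `E` (C(i)) and the norms of `Y`, `H` (U)
  set Dμ : Fin 4 → ℝ := fun μ => ∑ x : TorusSite 4 2,
    (3 - ((Wc (x, μ) : Matrix.unitaryGroup (Fin 3) ℂ) : Matrix (Fin 3) (Fin 3) ℂ).trace.re) with hDμ_def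
  have him : ∀ μ : Fin 4, (∑ x : TorusSite 4 2, (E (x, μ)).trace).im = 0 := fun μ =>
    sum_trace_sub_one_im Wc μ fun x => hWinv x μ
  have hre : ∀ μ : Fin 4, (∑ x : TorusSite 4 2, (E (x, μ)).trace).re = -Dμ μ := fun μ =>
    sum_trace_sub_one_re Wc μ
  set nY : ℝ := ∑ e : Edge 4 2, ∑ a, ∑ b, ‖Y e a b‖ ^ 2 with hnY_def
  set nH : ℝ := ∑ e : Edge 4 2, ∑ a, ∑ b, ‖H e a b‖ ^ 2 with hnH_def
  set nYd : Fin 4 → ℝ := fun μ => ∑ x : TorusSite 4 2, ∑ a, ∑ b, ‖Y (x, μ) a b‖ ^ 2 with hnYd_def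
  set nHd : Fin 4 → ℝ := fun μ => ∑ x : TorusSite 4 2, ∑ a, ∑ b, ‖H (x, μ) a b‖ ^ 2 with hnHd_def
  have hDab : ∀ μ, 2 * Dμ μ = nYd μ + nHd μ := by
    intro μ
    rw [hDμ_def, hnYd_def, hnHd_def, Finset.mul_sum, ← Finset.sum_add_distrib]
    exact Finset.sum_congr rfl fun x _ => by rw [← hE2, hPyth]
  have hb : ∑ μ, nHd μ = nH := (sum_edge_eq_sum_dir fun e => ∑ a, ∑ b, ‖H e a b‖ ^ 2).symm
  have hnH0 : 0 ≤ nH := by rw [hnH_def]; positivity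
  have hb0 : ∀ μ, 0 ≤ nHd μ := fun μ => by rw [hnHd_def]; positivity
  have hD2 : ∑ e : Edge 4 2, ∑ a, ∑ b, ‖E e a b‖ ^ 2 = 2 * D := by
    rw [hD_def, Finset.mul_sum]
    exact Finset.sum_congr rfl fun e _ => hE2 e
  have hnY : nY ≤ 2 * D := by
    rw [← hD2, hnY_def]
    exact Finset.sum_le_sum fun e _ => by rw [hPyth e]; exact le_add_of_nonneg_right (by positivity)
  have hnH : nH ≤ η * D := by
    rw [hD_def, hnH_def, Finset.mul_sum]
    exact Finset.sum_le_sum fun e _ => hHle e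
  -- the Bloch phases, the free symbol and the coercivity of the free blocks
  set θ : (Fin 4 → Fin M) → Fin 4 → ℝ := fun k μ =>
    Real.pi * ((k μ : ℕ) : ℝ) / M + Real.pi / (2 * M) with hθ_def
  have hu : ∀ (k : Fin 4 → Fin M) (μ : Fin 4),
      (((fun ν => ζ k ν * ω) μ : Matrix.unitaryGroup (Fin 3) ℂ) : Matrix (Fin 3) (Fin 3) ℂ) =
        Complex.exp (↑(θ k μ) * Complex.I) • (1 : Matrix (Fin 3) (Fin 3) ℂ) :=
    fun k μ => coe_zeta_mul_omega hω (hζ k μ)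
  set hh : (Fin 4 → Fin M) → (Fin 4 → ZMod 2) → ℝ := fun k s =>
    (m + ∑ μ : Fin 4, (1 - Real.cos (Real.pi * ((s μ).val : ℝ) + θ k μ))) ^ 2 +
      ∑ μ : Fin 4, Real.sin (Real.pi * ((s μ).val : ℝ) + θ k μ) ^ 2 with hhh_def
  have hpos : ∀ k s, 0 < hh k s := fun k s => symbol_pos m k s
  have hmin : ∀ k, ∃ s₁, ∀ s, hh k s₁ ≤ hh k s := fun k => by
    obtain ⟨s₁, -, h⟩ := Finset.exists_min_image Finset.univ (hh k) Finset.univ_nonempty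
    exact ⟨s₁, fun s => h s (Finset.mem_univ s)⟩
  choose s₀ hs₀ using hmin
  set c₀ : (Fin 4 → Fin M) → ℝ := fun k => hh k (s₀ k) with hc₀_def
  have hc₀ : ∀ k, 0 < c₀ k := fun k => hpos k _
  set B0 : (Fin 4 → Fin M) →
      Matrix (TorusSite 4 2 × Fin 3 × Fin 4) (TorusSite 4 2 × Fin 3 × Fin 4) ℂ := fun k =>
    wilsonDirac (unitaryFundamentalRep (Fin 3) ℂ) (fun e : Edge 4 2 => ζ k e.2 * ω) m 1 with hB0_def
  have hcoer : ∀ (k : Fin 4 → Fin M) (v : TorusSite 4 2 × Fin 3 × Fin 4 → ℂ),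
      c₀ k * ∑ i, ‖v i‖ ^ 2 ≤ ∑ i, ‖((B0 k).mulVec v) i‖ ^ 2 := fun k =>
    (stub_freeBlochBlocks (θ k) m (fun ν => ζ k ν * ω) (hu k)).2 (c₀ k) (hs₀ k)
  -- the hopping form `Δ_k`, `ℓ_k`, `𝔅_k`, the test fields
  set Dl : (Fin 4 → Fin M) → (Edge 4 2 → Matrix (Fin 3) (Fin 3) ℂ) →
      Matrix (TorusSite 4 2 × Fin 3 × Fin 4) (TorusSite 4 2 × Fin 3 × Fin 4) ℂ := fun k E' =>
    Matrix.of fun p q => -(1 / 2 : ℂ) * ∑ μ : Fin 4, ((if q.1 = Site.shift p.1 μ then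
      ((1 : Matrix (Fin 4) (Fin 4) ℂ) - euclideanGamma μ) p.2.2 q.2.2 *
        (((ζ k μ * ω : Matrix.unitaryGroup (Fin 3) ℂ) : Matrix (Fin 3) (Fin 3) ℂ) * E' (p.1, μ))
          p.2.1 q.2.1 else 0) + (if p.1 = Site.shift q.1 μ then
      ((1 : Matrix (Fin 4) (Fin 4) ℂ) + euclideanGamma μ) p.2.2 q.2.2 *
        (((ζ k μ * ω : Matrix.unitaryGroup (Fin 3) ℂ) : Matrix (Fin 3) (Fin 3) ℂ) * E' (q.1, μ))ᴴ
          p.2.1 q.2.1 else 0)) with hDl_def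
  set ell : (Fin 4 → Fin M) → (Edge 4 2 → Matrix (Fin 3) (Fin 3) ℂ) → ℝ := fun k E' =>
    ((B0 k)⁻¹ * Dl k E').trace.re with hell_def
  set bf : (Fin 4 → Fin M) → (Edge 4 2 → Matrix (Fin 3) (Fin 3) ℂ) →
      (Edge 4 2 → Matrix (Fin 3) (Fin 3) ℂ) → ℝ := fun k E₁ E₂ =>
    ((B0 k)⁻¹ * Dl k E₁ * ((B0 k)⁻¹ * Dl k E₂)).trace.re with hbf_def
  set tst : Fin 4 → (Edge 4 2 → Matrix (Fin 3) (Fin 3) ℂ) := fun μ e =>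
    if e = ((0 : TorusSite 4 2), μ) then (1 / 3 : ℂ) • (1 : Matrix (Fin 3) (Fin 3) ℂ) else 0
    with htst_def
  -- (Bd) the bilinear bounds, block by block
  have hBdk : ∀ k : Fin 4 → Fin M,
      (∀ E₁ E₂ : Edge 4 2 → Matrix (Fin 3) (Fin 3) ℂ, Dl k (E₁ + E₂) = Dl k E₁ + Dl k E₂) ∧
      (∀ (r : ℝ) (E' : Edge 4 2 → Matrix (Fin 3) (Fin 3) ℂ), Dl k (r • E') = (r : ℂ) • Dl k E') ∧
      (∀ E₁ E₂ : Edge 4 2 → Matrix (Fin 3) (Fin 3) ℂ, |bf k E₁ E₂| ≤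
        32 / c₀ k * Real.sqrt (∑ e, ∑ a, ∑ b, ‖E₁ e a b‖ ^ 2) *
          Real.sqrt (∑ e, ∑ a, ∑ b, ‖E₂ e a b‖ ^ 2)) ∧
      (∀ E' : Edge 4 2 → Matrix (Fin 3) (Fin 3) ℂ, |ell k E'| ≤
        80 / Real.sqrt (c₀ k) * Real.sqrt (∑ e, ∑ a, ∑ b, ‖E' e a b‖ ^ 2)) :=
    fun k => hBd m (fun ν => ζ k ν * ω) (c₀ k) (hc₀ k) (hcoer k)
  -- (T) the tadpole, block by block
  have hTk : ∀ (k : Fin 4 → Fin M) (E' : Edge 4 2 → Matrix (Fin 3) (Fin 3) ℂ),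
      (∀ μ : Fin 4, (∑ x : TorusSite 4 2, (E' (x, μ)).trace).im = 0) →
        ell k E' = ∑ μ : Fin 4, ell k (tst μ) * (∑ x : TorusSite 4 2, (E' (x, μ)).trace).re :=
    fun k => hT m (θ k) (fun ν => ζ k ν * ω) (hu k)
  -- (Mg) the Hessian margin at `Y`
  have hMgY : c' * (M : ℝ) ^ 4 * K ≤ (∑ k : Fin 4 → Fin M, bf k Y Y) / 2 +
      (∑ μ : Fin 4, (∑ k : Fin 4 → Fin M, ell k (tst μ)) * nYd μ) / 2 :=
    hMg M hM m hmH ω ζ hω hζ Y hYanti hYodd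
  -- (0) `B_k − B⁰_k = Δ_k(E)`
  have hΔ : ∀ k : Fin 4 → Fin M, wilsonDirac (unitaryFundamentalRep (Fin 3) ℂ)
      (fun e : Edge 4 2 => ζ k e.2 * ω * Wc e) m 1 - B0 k = Dl k E :=
    fun k => wilsonDirac_dir_sub_eq (fun ν => ζ k ν * ω) Wc m E fun e => rfl
  have hq : ∀ k : Fin 4 → Fin M,
      (R k).trace.re - ((R k) * (R k)).trace.re / 2 = ell k E - bf k E E / 2 := by
    intro k
    show ((B0 k)⁻¹ * (wilsonDirac (unitaryFundamentalRep (Fin 3) ℂ)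
        (fun e : Edge 4 2 => ζ k e.2 * ω * Wc e) m 1 - B0 k)).trace.re -
      ((B0 k)⁻¹ * (wilsonDirac (unitaryFundamentalRep (Fin 3) ℂ)
        (fun e : Edge 4 2 => ζ k e.2 * ω * Wc e) m 1 - B0 k) *
        ((B0 k)⁻¹ * (wilsonDirac (unitaryFundamentalRep (Fin 3) ℂ)
          (fun e : Edge 4 2 => ζ k e.2 * ω * Wc e) m 1 - B0 k))).trace.re / 2 =
      ell k E - bf k E E / 2
    rw [hΔ k]
  -- (2) `𝔅_k(E,E) = 𝔅_k(Y,Y) + [𝔅_k(Y,H) + 𝔅_k(H,Y) + 𝔅_k(H,H)]`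
  have hEYH : E = Y + H := (add_sub_cancel Y E).symm
  have hbfE : ∀ k : Fin 4 → Fin M, bf k E E = bf k Y Y + (bf k Y H + bf k H Y + bf k H H) := by
    intro k
    have hDlE : Dl k E = Dl k Y + Dl k H := by rw [hEYH]; exact (hBdk k).1 Y H
    have h := re_trace_add_mul_add ((B0 k)⁻¹ * Dl k Y) ((B0 k)⁻¹ * Dl k H)
    rw [← Matrix.mul_add, ← hDlE] at h
    exact h
  have hQ : ∑ k : Fin 4 → Fin M, ((R k).trace.re - ((R k) * (R k)).trace.re / 2) =
      ∑ k : Fin 4 → Fin M, ell k E - (∑ k : Fin 4 → Fin M, bf k Y Y +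
        ∑ k : Fin 4 → Fin M, (bf k Y H + bf k H Y + bf k H H)) / 2 := by
    rw [Finset.sum_congr rfl fun k _ => hq k, Finset.sum_sub_distrib, ← Finset.sum_add_distrib,
      Finset.sum_div]
    congr 1
    exact Finset.sum_congr rfl fun k _ => by rw [hbfE k]
  -- (1) the tadpole: `Σ_k ℓ_k(E) = −Σ_μ T_μ D_μ`
  have hL : ∑ k : Fin 4 → Fin M, ell k E =
      -∑ μ : Fin 4, (∑ k : Fin 4 → Fin M, ell k (tst μ)) * Dμ μ := by
    have h1 : ∀ k, ell k E = ∑ μ, ell k (tst μ) * (-Dμ μ) := fun k => by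
      rw [hTk k E him]
      exact Finset.sum_congr rfl fun μ _ => by rw [hre μ]
    rw [Finset.sum_congr rfl fun k _ => h1 k, Finset.sum_comm, ← Finset.sum_neg_distrib]
    exact Finset.sum_congr rfl fun μ _ => by
      simp only [mul_neg, Finset.sum_neg_distrib, Finset.sum_mul]
  -- (6) the lattice sums: `c₀⁻¹, c₀^{-1/2} ≤ c₀^{-3/2} + 1`, `Σ_k c₀(k)^{-3/2} ≤ C_Σ M⁴`
  set t : (Fin 4 → Fin M) → ℝ := fun k => Real.sqrt (c₀ k) / c₀ k ^ 2 with ht_def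
  have ht1 : ∀ k, 1 / c₀ k ≤ t k + 1 := fun k => inv_le (c₀ k) (hc₀ k)
  have ht2 : ∀ k, 1 / Real.sqrt (c₀ k) ≤ t k + 1 := fun k => inv_sqrt_le (c₀ k) (hc₀ k)
  have ht0 : ∀ k, 0 ≤ t k + 1 := fun k =>
    add_nonneg (div_nonneg (Real.sqrt_nonneg _) (sq_nonneg _)) zero_le_one
  set Λ : ℝ := ∑ k : Fin 4 → Fin M, (t k + 1) with hΛ_def
  have hΛ0 : 0 ≤ Λ := Finset.sum_nonneg fun k _ => ht0 k
  have hM4 : (1 : ℝ) ≤ (M : ℝ) ^ 4 := one_le_pow₀ (by exact_mod_cast NeZero.one_le)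
  have hΛ : Λ ≤ (max CS 0 + 1) * (M : ℝ) ^ 4 := by
    have h1 : ∑ k, t k ≤ CS * (M : ℝ) ^ 4 :=
      calc ∑ k, t k ≤ ∑ k : Fin 4 → Fin M, ∑ s : Fin 4 → ZMod 2, Real.sqrt (hh k s) / hh k s ^ 2 :=
            Finset.sum_le_sum fun k _ => Finset.single_le_sum
              (f := fun s => Real.sqrt (hh k s) / hh k s ^ 2)
              (fun s _ => div_nonneg (Real.sqrt_nonneg _) (sq_nonneg _)) (mem_univ (s₀ k))
        _ ≤ CS * (M : ℝ) ^ 4 := hLS M m hmS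
    have h2 : ∑ _k : Fin 4 → Fin M, (1 : ℝ) = (M : ℝ) ^ 4 := by
      rw [Finset.sum_const, Finset.card_univ, Fintype.card_fun, Fintype.card_fin, Fintype.card_fin,
        nsmul_eq_mul, mul_one, Nat.cast_pow]
    have h3 : CS * (M : ℝ) ^ 4 ≤ max CS 0 * (M : ℝ) ^ 4 :=
      mul_le_mul_of_nonneg_right (le_max_left _ _) (pow_nonneg (Nat.cast_nonneg _) 4)
    rw [hΛ_def, Finset.sum_add_distrib, h2, add_mul, one_mul]
    exact add_le_add (h1.trans h3) le_rfl
  -- the tadpole coefficients `|T_μ| ≤ 80 Λ`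
  have hell_tst : ∀ (k : Fin 4 → Fin M) (μ : Fin 4), |ell k (tst μ)| ≤ 80 * (t k + 1) := by
    intro k μ
    have h := (hBdk k).2.2.2 (tst μ)
    rw [htst_def, tst_norm_sq μ, ← htst_def] at h
    have h80 : 0 ≤ 80 / Real.sqrt (c₀ k) := div_nonneg (by norm_num) (Real.sqrt_nonneg _)
    calc |ell k (tst μ)| ≤ 80 / Real.sqrt (c₀ k) * Real.sqrt (1 / 3) := h
      _ ≤ 80 / Real.sqrt (c₀ k) * 1 :=
          mul_le_mul_of_nonneg_left (Real.sqrt_le_one.2 (by norm_num)) h80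
      _ = 80 * (1 / Real.sqrt (c₀ k)) := by ring
      _ ≤ 80 * (t k + 1) := mul_le_mul_of_nonneg_left (ht2 k) (by norm_num)
  have hTb : ∀ μ, |∑ k : Fin 4 → Fin M, ell k (tst μ)| ≤ 80 * Λ := fun μ =>
    (Finset.abs_sum_le_sum_abs _ _).trans (by
      rw [hΛ_def, Finset.mul_sum]
      exact Finset.sum_le_sum fun k _ => hell_tst k μ)
  -- the mixed errors `|𝔅_k(Y,H) + 𝔅_k(H,Y) + 𝔅_k(H,H)| ≤ 32 (t_k + 1) (2‖Y‖‖H‖ + ‖H‖²)`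
  have hmix0 : 0 ≤ 2 * Real.sqrt nY * Real.sqrt nH + nH :=
    add_nonneg (mul_nonneg (mul_nonneg zero_le_two (Real.sqrt_nonneg _)) (Real.sqrt_nonneg _)) hnH0
  have herr : ∀ k : Fin 4 → Fin M, |bf k Y H + bf k H Y + bf k H H| ≤
      32 * (t k + 1) * (2 * Real.sqrt nY * Real.sqrt nH + nH) := by
    intro k
    obtain ⟨-, -, hb2, -⟩ := hBdk k
    have h1 : |bf k Y H| ≤ 32 / c₀ k * Real.sqrt nY * Real.sqrt nH := hb2 Y H
    have h2 : |bf k H Y| ≤ 32 / c₀ k * Real.sqrt nH * Real.sqrt nY := hb2 H Y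
    have h3 : |bf k H H| ≤ 32 / c₀ k * Real.sqrt nH * Real.sqrt nH := hb2 H H
    have h4 : Real.sqrt nH * Real.sqrt nH = nH := Real.mul_self_sqrt hnH0
    have h5 : 32 / c₀ k ≤ 32 * (t k + 1) :=
      calc 32 / c₀ k = 32 * (1 / c₀ k) := by ring
        _ ≤ 32 * (t k + 1) := mul_le_mul_of_nonneg_left (ht1 k) (by norm_num)
    calc |bf k Y H + bf k H Y + bf k H H| ≤ |bf k Y H| + |bf k H Y| + |bf k H H| :=
          abs_add_three _ _ _
      _ ≤ 32 / c₀ k * Real.sqrt nY * Real.sqrt nH + 32 / c₀ k * Real.sqrt nH * Real.sqrt nY +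
            32 / c₀ k * Real.sqrt nH * Real.sqrt nH := add_le_add_three h1 h2 h3
      _ = 32 / c₀ k * (2 * Real.sqrt nY * Real.sqrt nH + Real.sqrt nH * Real.sqrt nH) := by ring
      _ = 32 / c₀ k * (2 * Real.sqrt nY * Real.sqrt nH + nH) := by rw [h4]
      _ ≤ 32 * (t k + 1) * (2 * Real.sqrt nY * Real.sqrt nH + nH) :=
          mul_le_mul_of_nonneg_right h5 hmix0
  have hER : |∑ k : Fin 4 → Fin M, (bf k Y H + bf k H Y + bf k H H)| ≤
      32 * Λ * (2 * Real.sqrt nY * Real.sqrt nH + nH) :=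
    (Finset.abs_sum_le_sum_abs _ _).trans (by
      rw [hΛ_def, Finset.mul_sum, Finset.sum_mul]
      exact Finset.sum_le_sum fun k _ => herr k)
  -- the real bookkeeping
  rw [hQ]
  exact bookkeeping rfl hL hDab hMgY hTb hER hb hb0 hK hnY hnH hη0 hη1 hD0 hDF hΛ hΛ0
    (le_max_right _ _) hM4 hc'

/-- **P6 — `oneLoopMargin` (v10's residual), now DERIVED** from T, C, U, Bd, Mg by the assembly. -/
theorem stub_oneLoopMargin : ∃ cq Cq Kq ε η₀ : ℝ, 0 < cq ∧ 0 < ε ∧ 0 < η₀ ∧ ∃ M₀ : ℕ, ∀ (M : ℕ) [NeZero M], M₀ ≤ M → ∀ (m : ℝ), |m| ≤ ε → ∀ (V : GaugeConfig 4 (2 * M) (Matrix.unitaryGroup (Fin 3) ℂ)) (c : Site 4 (2 * M)) (ω : Matrix.unitaryGroup (Fin 3) ℂ) (ζ : (Fin 4 → Fin M) → Fin 4 → Matrix.unitaryGroup (Fin 3) ℂ), ((ω : Matrix.unitaryGroup (Fin 3) ℂ) : Matrix (Fin 3) (Fin 3) ℂ) = Complex.exp (↑(Real.pi / (2 * M :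 ℕ)) * Complex.I) • (1 : Matrix (Fin 3) (Fin 3) ℂ) → (∀ k μ, ((ζ k μ : Matrix.unitaryGroup (Fin 3) ℂ) : Matrix (Fin 3) (Fin 3) ℂ) = Complex.exp (Real.pi * Complex.I * ((k μ : ℕ) : ℂ) / (M : ℂ)) • (1 : Matrix (Fin 3) (Fin 3) ℂ)) → ∀ η : ℝ, η ≤ η₀ → (∀ e : Edge 4 (2 * M), ((∀ ν, (e.1 ν - c ν).val ≤ 1) ∧ (e.1 e.2 - c e.2).val = 0) → 3 - ((V e : Matrix.unitaryGroup (Fin 3) ℂ) : Matrix (Fin 3) (Fin 3) ℂ).trace.re ≤ η) → let tile : Site 4 (2 * M) → GaugeConfig 4 (2 * M) (Matrix.unitaryGroup (Fin 3) ℂ) → GaugeConfig 4 (2 * M) (Matrix.unitaryGroup (Fin 3) ℂ) := fun c V e => if (e.1 e.2 - c e.2).val % 2 = 0 then V (fun ν => c ν + (((e.1 ν - c ν).val % 2 : ℕ) : ZMod (2 * M)), e.2) else (V (fun ν => c ν + (((Site.shift e.1 e.2 ν - c ν).val % 2 : ℕ) : ZMod (2 * M)), e.2))⁻¹; let Wc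 : GaugeConfig 4 2 (Matrix.unitaryGroup (Fin 3) ℂ) := fun e => tile c V (fun ν => c ν + (((e.1 ν).val : ℕ) : ZMod (2 * M)), e.2); let R : (Fin 4 → Fin M) → Matrix (TorusSite 4 2 × Fin 3 × Fin 4) (TorusSite 4 2 × Fin 3 × Fin 4) ℂ := fun k => (wilsonDirac (unitaryFundamentalRep (Fin 3) ℂ) (fun e : Edge 4 2 => ζ k e.2 * ω) m 1)⁻¹ * (wilsonDirac (unitaryFundamentalRep (Fin 3) ℂ) (fun e : Edge 4 2 => ζ k e.2 * ω * Wc e) m 1 - wilsonDirac (unitaryFundamentalRep (Fin 3) ℂ) (fun e : Edge 4 2 => ζ k e.2 * ω) m 1); ∑ k : Fin 4 → Fin M, ((R k).trace.re - ((R k) * (R k)).trace.re / 2) ≤ Kq - cq * (M : ℝ) ^ 4 * ∑ p ∈ univ.filter (fun p : Plaquette 4 (2 * M) => p.1 p.2.1.1 = c p.2.1.1 ∧ p.1 p.2.1.2 = c p.2.1.2 ∧ ∀ ν, ν ≠ p.2.1.1 → ν ≠ p.2.1.2 → (p.1 ν = c ν ∨ p.1 ν = c ν + 1)), (3 - (unitaryFundamentalRep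 (Fin 3) ℂ (plaquetteHolonomy V p.1 p.2.1.1 p.2.1.2)).trace.re) + Cq * Real.sqrt η * (M : ℝ) ^ 4 * ∑ e ∈ univ.filter (fun e : Edge 4 (2 * M) => (∀ ν, (e.1 ν - c ν).val ≤ 1) ∧ (e.1 e.2 - c e.2).val = 0), (3 - ((V e : Matrix.unitaryGroup (Fin 3) ℂ) : Matrix (Fin 3) (Fin 3) ℂ).trace.re) :=
  stub_oneLoopMargin_of stub_tadpole stub_tilingCombinatorics stub_unitaryCellIneq stub_bilinearBounds
    stub_hessianMargin

end Summit.QuantumFields.QCD.Cruxes.CriticalLineDiamagnetism.ChessboardCellGain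

end
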